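import Mathlib
import Literature.Geometry.Lorentzian.KlainermanSzeftel2021.Bootstrap

/-!
# Runbook sanity module — the Klainerman–Szeftel (2021) bootstrap SKELETON is not vacuous

`Literature.Geometry.Lorentzian.KlainermanSzeftel2021.Bootstrap.mainTheorem_of_leaves` (bundle
`papers/FinalStateConjecture/kerr-skeleton`, REVIEW-RUNBOOK.md cards S1, C1–C25) takes four objects
(`c : Constants`, `K : LesConstants`, `S : Setting c`, `O : M7Objects S`) and twenty-five hypotheses
(the admissible regime of the constants, `ε0 < 1`, the initial-data comparison, two explicit
smallness thresholds, and twenty typed statement SHAPES: Theorems M1–M6, the chapter-8 sub-nodes of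
M7, the chapter-9 sub-nodes of M8, the three steps KS assert without proof) and concludes
`MainTheoremV2 K S`.  The kernel certifies that implication; this module certifies that it is not
vacuously true and that its most delicate hypothesis carries weight:

* `admissible_toyConstants` — the thirteen constraints of `Constants.Admissible` (KS (3.4.1)–(3.4.4))
  are JOINTLY satisfiable (`m0 = 1, a0 = 0, klarge = 5, ε0 = 1/8, ε = 1/4 = ε0^{2/3}, r0 = 2, δH = 1,
  δdec = 1/4, δB = 1, δ_* = 1`);
* `hypotheses_jointly_satisfiable` — there are `c, K, S, O` satisfying ALL twenty-five hypotheses of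
  `mainTheorem_of_leaves` at once, so the hypothesis telescope is consistent and the theorem is a
  genuine implication, not `False → _`.  The witness is a TOY setting (`toySetting True`): the
  "spacetimes" are the real numbers `u_*` themselves, every norm is identically `0`, every universal
  constant is `1`, every opaque predicate is `True`;
* `limitExists_not_idle` — in the same toy setting WITHOUT a limit object (`toySetting False`:
  `IsLimitOfU := False`) the other twenty-four hypotheses hold, `LimitExists` fails, and the conclusion
  `MainTheoremV2` FAILS: the unproved step `LimitExists` (the passage to the limit `u_* → ∞`, the
  cell's GAPS.md Q2) cannot be dropped from the statement.

Nothing here is a claim about Kerr stability; these are (b)-type sanity witnesses for the review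
runbook (inhabitedness / non-vacuity of the hypothesis cards), kernel-checked with the standard
axioms.  The toy objects are `def`s so that a reader sees them once; they are used by nothing else.
-/

namespace Summit.FinalStateConjecture.Runbook.KerrSkeleton

open Literature.Geometry.Lorentzian.KlainermanSzeftel2021.Bootstrap

noncomputable section

/-- The one irrational-exponent identity the admissible regime needs: `(1/8)^{2/3} = 1/4`. -/
theorem one_eighth_rpow_two_thirds : (1 / 8 : ℝ) ^ ((2 : ℝ) / 3) = 1 / 4 := by
  rw [show (1 / 8 : ℝ) = (1 / 2 : ℝ) ^ (3 : ℕ) by norm_num, ← Real.rpow_natCast,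
    ← Real.rpow_mul (by norm_num)]
  rw [show ((3 : ℕ) : ℝ) * ((2 : ℝ) / 3) = ((2 : ℕ) : ℝ) by norm_num, Real.rpow_natCast]
  norm_num

/-- Toy constants in the admissible regime: `m0 = 1, a0 = 0, klarge = 5, ε0 = 1/8, ε = 1/4, r0 = 2,
δH = 1, δdec = 1/4, δB = 1, δ_* = 1` (field order of `Constants`). -/
def toyConstants : Constants := ⟨1, 0, 5, 1 / 8, 1 / 4, 2, 1, 1 / 4, 1, 1⟩

/-- Toy `≲`-constants: all ten equal to `1`. -/
def toyLes : LesConstants := ⟨1, 1, 1, 1, 1, 1, 1, 1, 1, 1⟩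

/-- The toy setting over `toyConstants`: a "spacetime" IS its last-sphere value `u_* ∈ ℝ`
(`M := ℝ`, `ustar := id`); `rstar` is the dominance condition (3.4.5) read as a definition; mass `≡ m0 = 1`,
angular momentum `≡ a0 = 0`; every regional sup/decay norm, initial-data norm, M0/M1/M2 quantity and
PT norm is identically `0` (monotone and non-negative trivially); `Extends`, `BuiltByM7`, `iter` are
`True`; there is one limit object (`Minf := Unit`) with vanishing limiting norms and `Conclusions ≡ True`;
whether it IS a limit of the family is the parameter `lim`. -/
def toySetting (lim : Prop) : Setting toyConstants where
  M := ℝ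
  ustar u := u
  rstar u := (1 : ℝ) * (1 / 8 : ℝ)⁻¹ * u ^ (1 + (1 / 4 : ℝ))
  mass _ := 1
  angm _ := 0
  starB _ _ := 0
  extB _ _ := 0
  intB _ _ := 0
  topB _ _ := 0
  starD _ _ := 0
  extD _ _ := 0
  intD _ _ := 0
  topD _ _ := 0
  starB_mono _ := monotone_const
  extB_mono _ := monotone_const
  intB_mono _ := monotone_const
  topB_mono _ := monotone_const
  starD_mono _ := monotone_const
  extD_mono _ := monotone_const
  intD_mono _ := monotone_const
  topD_mono _ := monotone_const
  starB_nonneg _ _ := le_rfl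
  extB_nonneg _ _ := le_rfl
  intB_nonneg _ _ := le_rfl
  topB_nonneg _ _ := le_rfl
  starD_nonneg _ _ := le_rfl
  extD_nonneg _ _ := le_rfl
  intD_nonneg _ _ := le_rfl
  topD_nonneg _ _ := le_rfl
  idl _ := 0
  idlExt3 := 0
  m0Ext _ := 0
  m0Int _ := 0
  m1Sup _ _ := 0
  m1Flux _ _ := 0
  m1A _ _ := 0
  m2Dec _ := 0
  m2Flux _ := 0
  Extends _ _ := True
  BuiltByM7 _ _ := True
  ptNorm _ _ := 0
  idlPT _ _ := 0
  iter _ _ := True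
  Minf := Unit
  nSupInf _ _ _ := 0
  nDecInf _ _ _ := 0
  IsLimitOfU _ := lim
  Conclusions _ _ _ := True

/-- Toy M7 objects over the toy setting: one extension datum, every predicate `True`. -/
def toyM7 (lim : Prop) : M7Objects (toySetting lim) := ⟨Unit, fun _ _ => True, fun _ => True, fun _ _ => True⟩

/-! ### Evaluation lemmas of the toy setting (all by `rfl`; they let `norm_num` see through the
projections, whose arguments live in the dependent type `(toySetting lim).M`) -/

section ToyEval
variable (lim : Prop)

/-- toy setting: the regional norm `starB` vanishes. -/
@[simp] theorem toySetting_starB (X : (toySetting lim).M) (k : ℕ) : (toySetting lim).starB X k = 0 := rfl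

/-- toy setting: the regional norm `extB` vanishes. -/
@[simp] theorem toySetting_extB (X : (toySetting lim).M) (k : ℕ) : (toySetting lim).extB X k = 0 := rfl

/-- toy setting: the regional norm `intB` vanishes. -/
@[simp] theorem toySetting_intB (X : (toySetting lim).M) (k : ℕ) : (toySetting lim).intB X k = 0 := rfl

/-- toy setting: the regional norm `topB` vanishes. -/
@[simp] theorem toySetting_topB (X : (toySetting lim).M) (k : ℕ) : (toySetting lim).topB X k = 0 := rfl

/-- toy setting: the regional norm `starD` vanishes. -/
@[simp] theorem toySetting_starD (X : (toySetting lim).M) (k : ℕ) : (toySetting lim).starD X k = 0 := rfl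

/-- toy setting: the regional norm `extD` vanishes. -/
@[simp] theorem toySetting_extD (X : (toySetting lim).M) (k : ℕ) : (toySetting lim).extD X k = 0 := rfl

/-- toy setting: the regional norm `intD` vanishes. -/
@[simp] theorem toySetting_intD (X : (toySetting lim).M) (k : ℕ) : (toySetting lim).intD X k = 0 := rfl

/-- toy setting: the regional norm `topD` vanishes. -/
@[simp] theorem toySetting_topD (X : (toySetting lim).M) (k : ℕ) : (toySetting lim).topD X k = 0 := rfl

/-- toy setting: `mass ≡ 1`. -/
@[simp] theorem toySetting_mass (X : (toySetting lim).M) : (toySetting lim).mass X = 1 := rfl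

/-- toy setting: `angm ≡ 0`. -/
@[simp] theorem toySetting_angm (X : (toySetting lim).M) : (toySetting lim).angm X = 0 := rfl

/-- toy setting: `m0Ext ≡ 0`. -/
@[simp] theorem toySetting_m0Ext (X : (toySetting lim).M) : (toySetting lim).m0Ext X = 0 := rfl

/-- toy setting: `m0Int ≡ 0`. -/
@[simp] theorem toySetting_m0Int (X : (toySetting lim).M) : (toySetting lim).m0Int X = 0 := rfl

/-- toy setting: `m2Dec ≡ 0`. -/
@[simp] theorem toySetting_m2Dec (X : (toySetting lim).M) : (toySetting lim).m2Dec X = 0 := rfl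

/-- toy setting: `m2Flux ≡ 0`. -/
@[simp] theorem toySetting_m2Flux (X : (toySetting lim).M) : (toySetting lim).m2Flux X = 0 := rfl

/-- toy setting: `m1Sup ≡ 0`. -/
@[simp] theorem toySetting_m1Sup (X : (toySetting lim).M) (δ : ℝ) : (toySetting lim).m1Sup X δ = 0 := rfl

/-- toy setting: `m1Flux ≡ 0`. -/
@[simp] theorem toySetting_m1Flux (X : (toySetting lim).M) (δ : ℝ) : (toySetting lim).m1Flux X δ = 0 := rfl

/-- toy setting: `m1A ≡ 0`. -/
@[simp] theorem toySetting_m1A (X : (toySetting lim).M) (δ : ℝ) : (toySetting lim).m1A X δ = 0 := rfl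

/-- toy setting: `ptNorm ≡ 0`. -/
@[simp] theorem toySetting_ptNorm (X : (toySetting lim).M) (k : ℕ) : (toySetting lim).ptNorm X k = 0 := rfl

/-- toy setting: `idlPT ≡ 0`. -/
@[simp] theorem toySetting_idlPT (X : (toySetting lim).M) (k : ℕ) : (toySetting lim).idlPT X k = 0 := rfl

/-- toy setting: the initial-data norms vanish. -/
@[simp] theorem toySetting_idl (k : ℕ) : (toySetting lim).idl k = 0 := rfl

/-- toy setting: `idlExt3 = 0`. -/
@[simp] theorem toySetting_idlExt3 : (toySetting lim).idlExt3 = 0 := rfl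

/-- toy setting: the limiting norm `nSupInf` vanishes. -/
@[simp] theorem toySetting_nSupInf (Y : (toySetting lim).Minf) (a m : ℝ) : (toySetting lim).nSupInf Y a m = 0 := rfl

/-- toy setting: the limiting norm `nDecInf` vanishes. -/
@[simp] theorem toySetting_nDecInf (Y : (toySetting lim).Minf) (a m : ℝ) : (toySetting lim).nDecInf Y a m = 0 := rfl

/-- toy setting: `u_*` of the spacetime `u` is `u`. -/
@[simp] theorem toySetting_ustar (u : ℝ) : (toySetting lim).ustar u = u := rfl

end ToyEval

/-- **The admissible regime is non-empty**: `toyConstants` satisfies all thirteen fields of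
`Constants.Admissible` (`2 δdec = 1/2 < 1 = δB`, `max m0 1 = 1 < 2 = r0`, `1/δdec = 4 < 5 = klarge`,
`ε = 1/4 < 1 = m0 − |a0|`, `ε = ε0^{2/3}` by `one_eighth_rpow_two_thirds`). -/
theorem admissible_toyConstants : toyConstants.Admissible where
  m0_pos := by norm_num [toyConstants]
  abs_a0_lt := by norm_num [toyConstants]
  δH_pos := by norm_num [toyConstants]
  δdec_pos := by norm_num [toyConstants]
  δB_pos := by norm_num [toyConstants]
  δstar_pos := by norm_num [toyConstants]
  two_δdec_lt_δB := by norm_num [toyConstants]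
  r0_large := by norm_num [toyConstants]
  klarge_large := by norm_num [toyConstants]
  ε0_pos := by norm_num [toyConstants]
  ε_lt_one := by norm_num [toyConstants]
  ε_lt_gap := by norm_num [toyConstants]
  ε_eq := by
    show (1 / 4 : ℝ) = (1 / 8 : ℝ) ^ ((2 : ℝ) / 3)
    rw [one_eighth_rpow_two_thirds]

variable (lim : Prop)

/-- Every real `u` is the `u_*` of a toy spacetime in `𝒰(u)`: the dominance condition is the definition
of `rstar`, and BA-B / BA-D read `0 + |1 − 1| + |0 − 0| ≤ 1/4` and `0 ≤ 1/4`. -/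
theorem toy_inU (u : ℝ) : InU (toySetting lim) u u where
  ustar_eq := rfl
  dom := rfl
  baB := by norm_num [BA_B, NSup, toyConstants]
  baD := by norm_num [BA_D, NDec, toyConstants]

/-- Hence `𝒰 ⊇ [0, ∞)` in the toy setting. -/
theorem toy_mem_Uset {u : ℝ} (hu : 0 ≤ u) : u ∈ Uset (toySetting lim) := ⟨hu, u, toy_inU lim u⟩

/-- … and `𝒰` is not bounded above. -/
theorem toy_Uset_not_bddAbove : ¬ BddAbove (Uset (toySetting lim)) := by
  rintro ⟨b, hb⟩
  have h := hb (toy_mem_Uset lim (u := max b 0 + 1) (by positivity))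
  linarith [le_max_left b 0]

/-- `u + 1` is an M7 extension of `u` in the toy setting (all the `≲ ε0` clauses read `0 ≤ 1/8`). -/
theorem toy_isM7Extension (u : ℝ) : IsM7Extension toyLes (toySetting lim) u (u + 1) where
  extends_ := trivial
  built := trivial
  ustar_lt := by show u < u + 1; linarith
  dom := rfl
  init := by norm_num [toyLes, toyConstants]
  param := by norm_num [toyLes, toyConstants]
  dec := by norm_num [NDec, toyLes, toyConstants]

/-- Theorem M1's shape holds in the toy setting (`δextra := 1 > δdec`, all three quantities `0 ≤ 1/8`, `0 ≤ 1/64`). -/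
theorem toy_thmM1 : ThmM1 toyLes (toySetting lim) :=
  fun _ _ _ _ => ⟨1, by norm_num [toyConstants], by norm_num [toyLes, toyConstants],
    by norm_num [toyLes, toyConstants], by norm_num [toyLes, toyConstants]⟩

/-- Theorem M2's shape holds in the toy setting (`0 ≤ 1/8`, `0 ≤ 1/64`). -/
theorem toy_thmM2 : ThmM2 toyLes (toySetting lim) :=
  fun _ _ _ _ => ⟨by norm_num [toyLes, toyConstants], by norm_num [toyLes, toyConstants]⟩

/-- The edge M1, M2 → M3 holds in the toy setting (`0 ≤ 1/8`). -/
theorem toy_thmM3fromM1M2 : ThmM3fromM1M2 toyLes (toySetting lim) :=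
  fun _ _ _ _ _ _ => by norm_num [toyLes, toyConstants]

/-- The edge M3 → M4 holds in the toy setting (`0 ≤ 1/8`). -/
theorem toy_thmM4fromM3 : ThmM4fromM3 toyLes (toySetting lim) :=
  fun _ _ _ _ _ => by norm_num [toyLes, toyConstants]

/-- The edge M4 → M5 holds in the toy setting (`0 + 0 ≤ 1/8`). -/
theorem toy_thmM5fromM4 : ThmM5fromM4 toyLes (toySetting lim) :=
  fun _ _ _ _ _ => by norm_num [toyLes, toyConstants]

/-- Theorem M6 in the toy setting: `[1, 2] ⊆ [0, ∞) ⊆ 𝒰`. -/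
theorem toy_thmM6 : ThmM6 (toySetting lim) :=
  fun _ => ⟨1, one_pos, fun _ hu => toy_mem_Uset lim (by linarith [hu.1])⟩

/-- M7 extension step in the toy setting: the one extension datum. -/
theorem toy_m7Extend : M7Extend toyLes (toySetting lim) (toyM7 lim) :=
  fun _ _ _ _ _ _ => ⟨(), trivial⟩

/-- M7 new-slice step in the toy setting: `True`. -/
theorem toy_m7NewSlice : M7NewSlice (toySetting lim) (toyM7 lim) :=
  fun _ _ _ => trivial

/-- M7 assembly step in the toy setting: the new spacetime of `u` is `u + 1`. -/
theorem toy_m7Assemble : M7Assemble toyLes (toySetting lim) (toyM7 lim) :=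
  fun _ X _ _ _ _ _ => ⟨(show ℝ from X) + 1, trivial, toy_isM7Extension lim (show ℝ from X)⟩

/-- Theorem M0-PT's shape in the toy setting (`0 ≤ 1/8`). -/
theorem toy_thmM0PT : ThmM0PT toyLes (toySetting lim) :=
  fun _ _ _ _ _ => by norm_num [toyLes, toyConstants]

/-- Iteration base in the toy setting (`iter ≡ True`). -/
theorem toy_iterBase : IterBase toyLes (toySetting lim) :=
  fun _ _ _ _ _ _ => trivial

/-- Iteration step in the toy setting (`iter ≡ True`). -/
theorem toy_iterStep : IterStep (toySetting lim) :=
  fun _ _ _ _ _ _ _ => trivial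

/-- Top-order closure in the toy setting (PT bound `0 ≤ 1/8`). -/
theorem toy_iterTop : IterTop toyLes (toySetting lim) :=
  fun _ _ _ _ _ _ _ => by norm_num [toyLes, toyConstants]

/-- BA-PT on the extension in the toy setting (`0 ≤ 1/4`). -/
theorem toy_baPTonExtension : BAPTonExtension toyLes (toySetting lim) :=
  fun _ _ _ _ _ _ _ => by norm_num [toyConstants]

/-- M8 from the PT bound in the toy setting (`0 + 0 + 0 + 0 ≤ 1/8`). -/
theorem toy_m8ofPT : M8ofPT toyLes (toySetting lim) :=
  fun _ _ _ _ _ _ => by norm_num [NSup, toyLes, toyConstants]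

/-- `FlowClosed` holds vacuously in the toy setting: `𝒰` is not bounded above. -/
theorem toy_flowClosed : FlowClosed (toySetting lim) :=
  fun hb _ => absurd hb (toy_Uset_not_bddAbove lim)

/-- The main estimate (3.4.8) holds in the toy setting at `(a, m) = (a0, m0) = (0, 1)` for the one
limit object: `|0| < 1` and `0 + 0 + |0 − 0| + |1 − 1| ≤ 1 · (1/8)`. -/
theorem toy_mainEstimate : MainEstimate toyLes (toySetting lim) () 0 1 := by
  norm_num [MainEstimate, toyLes, toyConstants]

/-- The conclusions node in the toy setting (`Conclusions ≡ True`). -/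
theorem toy_thmConclusions : ThmConclusions toyLes (toySetting lim) :=
  fun _ _ _ _ => trivial

/-- With a limit object (`lim := True`) the passage to the limit holds in the toy setting. -/
theorem toy_limitExists : LimitExists toyLes (toySetting True) :=
  fun _ => ⟨(), trivial, 0, 1, toy_mainEstimate True⟩

/-- **All twenty-five hypotheses of `mainTheorem_of_leaves` are jointly satisfiable.**  The
conjunction is, binder for binder, the hypothesis list of `mainTheorem_of_leaves`
(`hc hε0 hext h87 h7 hs1 hs2 hM1 hM2 hM3 hM4 hM5 hM6 h71 h72 h73 hM0PT hIb hIs hIt hBAPT h8PT hflow hlim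
hconcl`); the witnesses are `toyConstants`, `toyLes`, `toySetting True`, `toyM7 True`. -/
theorem hypotheses_jointly_satisfiable :
    ∃ (c : Constants) (K : LesConstants) (S : Setting c) (O : M7Objects S),
      c.Admissible ∧ c.ε0 < 1 ∧ S.idlExt3 ≤ S.idl (c.klarge + 10) ∧
      0 < K.cM8 + K.cM7 ∧ 0 < K.cM7 ∧
      c.ε0 ≤ ((K.cM8 + K.cM7)⁻¹) ^ (3 : ℕ) ∧ c.ε0 ≤ (K.cM7⁻¹) ^ (3 : ℕ) ∧
      ThmM1 K S ∧ ThmM2 K S ∧ ThmM3fromM1M2 K S ∧ ThmM4fromM3 K S ∧ ThmM5fromM4 K S ∧ ThmM6 S ∧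
      M7Extend K S O ∧ M7NewSlice S O ∧ M7Assemble K S O ∧
      ThmM0PT K S ∧ IterBase K S ∧ IterStep S ∧ IterTop K S ∧ BAPTonExtension K S ∧ M8ofPT K S ∧
      FlowClosed S ∧ LimitExists K S ∧ ThmConclusions K S :=
  ⟨toyConstants, toyLes, toySetting True, toyM7 True, admissible_toyConstants,
    by norm_num [toyConstants], le_rfl, by norm_num [toyLes], by norm_num [toyLes],
    by norm_num [toyLes, toyConstants], by norm_num [toyLes, toyConstants],
    toy_thmM1 _, toy_thmM2 _, toy_thmM3fromM1M2 _, toy_thmM4fromM3 _, toy_thmM5fromM4 _, toy_thmM6 _,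
    toy_m7Extend _, toy_m7NewSlice _, toy_m7Assemble _,
    toy_thmM0PT _, toy_iterBase _, toy_iterStep _, toy_iterTop _, toy_baPTonExtension _, toy_m8ofPT _,
    toy_flowClosed _, toy_limitExists, toy_thmConclusions _⟩

/-- Applied to the toy witnesses, `mainTheorem_of_leaves` yields its conclusion — the theorem
instantiated with every side condition discharged (and, read backwards, a check that the conjunction
above really is its hypothesis list). -/
theorem toy_mainTheoremV2 : MainTheoremV2 toyLes (toySetting True) :=
  mainTheorem_of_leaves (O := toyM7 True) admissible_toyConstants (by norm_num [toyConstants]) le_rfl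
    (by norm_num [toyLes]) (by norm_num [toyLes]) (by norm_num [toyLes, toyConstants]) (by norm_num [toyLes, toyConstants])
    (toy_thmM1 _) (toy_thmM2 _) (toy_thmM3fromM1M2 _) (toy_thmM4fromM3 _) (toy_thmM5fromM4 _) (toy_thmM6 _)
    (toy_m7Extend _) (toy_m7NewSlice _) (toy_m7Assemble _)
    (toy_thmM0PT _) (toy_iterBase _) (toy_iterStep _) (toy_iterTop _) (toy_baPTonExtension _) (toy_m8ofPT _)
    (toy_flowClosed _) toy_limitExists (toy_thmConclusions _)

/-- **`LimitExists` is not idle.**  Without a limit object (`lim := False`) the twenty-four other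
hypotheses of `mainTheorem_of_leaves` still hold (they never mention `IsLimitOfU`), `LimitExists`
fails (`𝒰` is unbounded, and there is no limit), and the conclusion `MainTheoremV2` FAILS (its
initial-data hypothesis `IDLMain` reads `0 ≤ (1/8)²` and holds, but no `Y` is a limit).  So the
implication certified by the kernel is not provable from the other hypotheses alone: the unproved
step "passage to the limit `u_* → ∞`" (GAPS.md Q2) carries weight in the skeleton. -/
theorem limitExists_not_idle :
    ∃ (c : Constants) (K : LesConstants) (S : Setting c) (O : M7Objects S),
      (c.Admissible ∧ c.ε0 < 1 ∧ S.idlExt3 ≤ S.idl (c.klarge + 10) ∧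
        0 < K.cM8 + K.cM7 ∧ 0 < K.cM7 ∧
        c.ε0 ≤ ((K.cM8 + K.cM7)⁻¹) ^ (3 : ℕ) ∧ c.ε0 ≤ (K.cM7⁻¹) ^ (3 : ℕ) ∧
        ThmM1 K S ∧ ThmM2 K S ∧ ThmM3fromM1M2 K S ∧ ThmM4fromM3 K S ∧ ThmM5fromM4 K S ∧ ThmM6 S ∧
        M7Extend K S O ∧ M7NewSlice S O ∧ M7Assemble K S O ∧
        ThmM0PT K S ∧ IterBase K S ∧ IterStep S ∧ IterTop K S ∧ BAPTonExtension K S ∧ M8ofPT K S ∧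
        FlowClosed S ∧ ThmConclusions K S) ∧
      ¬ LimitExists K S ∧ ¬ MainTheoremV2 K S := by
  refine ⟨toyConstants, toyLes, toySetting False, toyM7 False, ⟨admissible_toyConstants,
    by norm_num [toyConstants], le_rfl, by norm_num [toyLes], by norm_num [toyLes],
    by norm_num [toyLes, toyConstants], by norm_num [toyLes, toyConstants],
    toy_thmM1 _, toy_thmM2 _, toy_thmM3fromM1M2 _, toy_thmM4fromM3 _, toy_thmM5fromM4 _, toy_thmM6 _,
    toy_m7Extend _, toy_m7NewSlice _, toy_m7Assemble _,
    toy_thmM0PT _, toy_iterBase _, toy_iterStep _, toy_iterTop _, toy_baPTonExtension _, toy_m8ofPT _,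
    toy_flowClosed _, toy_thmConclusions _⟩, ?_, ?_⟩
  · intro h
    obtain ⟨_, hY, _⟩ := h (toy_Uset_not_bddAbove False)
    exact hY
  · intro h
    obtain ⟨_, hY, _⟩ := h (by norm_num [IDLMain, toyConstants])
    exact hY

end

end Summit.FinalStateConjecture.Runbook.KerrSkeleton
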